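import Mathlib
import HarnessLib
import Summits.NavierStokesRegularity.NavierStokesRegularity.Theorems.LocalSineTubeDoorGenericDoor
import Summits.NavierStokesRegularity.NavierStokesRegularity.Theorems.LocalSineTubeDoorSequentialDoor
import Summits.NavierStokesRegularity.NavierStokesRegularity.Theorems.LocalSineTubeDoorSequentialCrossDoor
import Summits.NavierStokesRegularity.NavierStokesRegularity.Theorems.LocalSineTubeDoorMostTimesCrossDoor
import Summits.NavierStokesRegularity.NavierStokesRegularity.Theorems.LocalSineTubeDoorMostTimesFixedDirectionDoor
import Summits.NavierStokesRegularity.NavierStokesRegularity.Theorems.LocalSineTubeDoorProfileAlignedWindowRigidityPlanarity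
import Summits.NavierStokesRegularity.NavierStokesRegularity.Theorems.PoloidalWindowDoorPoloidalWindowRigidityOneSlice
import Summits.NavierStokesRegularity.NavierStokesRegularity.Theorems.LocalSineTubeDoorOneDirectionDoor
import Literature.Analysis.FluidPDE.SpaceTimeMollifier

/-!
# The one-window door family — VELOCITY-DIRECTION doors (unconditional): coherent velocity directions on one similarity
# window, even only along a sparse sequence of times, rule out a locally Type-I singularity

Cell ns-regularity-ideate, seat p6 (route-directed support for nsreg-p1's door family; anchor
`--supports stmt-NavierStokesRegularity-20017`; rung N0-LocalTubeDoorSine neighbourhood).  The velocity-direction counterparts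
of the sine door (`ω × e`) and of the cross door (`ω(x) × ω(y)`): the scalars `F(x, A) = ‖x × e‖` (velocity parallel to a
FIXED direction `e ≠ 0`) and `F(x, A, x', A') = ‖x × x'‖` (velocities PAIRWISE parallel).  The ONE-SLICE cruxes are tree
consequences: a Type-I profile with `v(s) × e = 0` on a nonempty open window of ONE slice has `v(s) ∥ e` everywhere
(slice analyticity), so `v(s) = φ e` with `∂ₑφ = div v(s) = 0`, i.e. `∂ₑ v(s) ≡ 0`, and the slice is translation-invariant
along `e` — then `v ≡ 0` by `…OneSlice.eq_zero_of_translate_eq_slice`; pairwise-parallel velocities on a window are parallel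
to one fixed vector (or vanish on the window, which also forces `v ≡ 0`).  Doors (classical Leray–Hopf on `[0,T)` from
rapidly decaying data, LOCALLY Type I at `(x₀, T)`, `U` nonempty open):

* `localTubeDoorVelocityDirection`, `sequentialVelocityDirectionDoor`, `mostTimesVelocityDirectionDoor` —
  `∫_U √(T−t) ‖u(t, x₀+√(T−t)y) × e‖ dy → 0` (all times / bounded-gap times / density-one times) ⇒ backward bounded;
* `sequentialVelocityCrossDoor`, `mostTimesVelocityCrossDoor` — `∬_{U×U} (T−t) ‖u(t,x₀+√(T−t)y) × u(t,x₀+√(T−t)y')‖ → 0`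
  (direction-free pairwise coherence) along bounded-gap / density-one times ⇒ backward bounded.

So at a locally Type-I singularity the VELOCITY DIRECTIONS must keep swirling on every similarity window at almost every
time, exactly as the vorticity directions must (sine / cross doors).

WHAT THIS IS NOT: not a claim about Navier–Stokes regularity (Clay A) — local, conditional-on-Type-I regularity CRITERIA
(bears_on LADDER-NS N0); establishment in the cell's sense needs the cross-family referee PASS + independent reproduction.
-/

noncomputable section

-- the summit and its single sub-problem share the name (CONVENTIONS §1), as in every Theorems file
set_option linter.dupNamespace false

namespace Summit.NavierStokesRegularity.NavierStokesRegularity.Theorems.LocalSineTubeDoorVelocityDirectionDoor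

open MeasureTheory Set Function Filter Topology TopologicalSpace Metric
open scoped RealInnerProductSpace InnerProductSpace NNReal ENNReal
open Literature.Analysis Literature.Analysis.FluidPDE
open Summit.NavierStokesRegularity.NavierStokesRegularity.Theorems.LocalSineTubeDoorProfileAlignedWindowRigidityAncient
open Summit.NavierStokesRegularity.NavierStokesRegularity.Theorems.LocalSineTubeDoorProfileAlignedWindowRigidityPlanarity
open Summit.NavierStokesRegularity.NavierStokesRegularity.Theorems.PoloidalWindowDoorPoloidalWindowRigidityFlat
open Summit.NavierStokesRegularity.NavierStokesRegularity.Theorems.PoloidalWindowDoorPoloidalWindowRigidityOneSlice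
open Summit.NavierStokesRegularity.NavierStokesRegularity.Theorems.LocalSineTubeDoorGenericDoor
open Summit.NavierStokesRegularity.NavierStokesRegularity.Theorems.LocalSineTubeDoorSequentialDoor
open Summit.NavierStokesRegularity.NavierStokesRegularity.Theorems.LocalSineTubeDoorSequentialCrossDoor
open Summit.NavierStokesRegularity.NavierStokesRegularity.Theorems.LocalSineTubeDoorMostTimesCrossDoor
open Summit.NavierStokesRegularity.NavierStokesRegularity.Theorems.LocalSineTubeDoorMostTimesFixedDirectionDoor
open Summit.NavierStokesRegularity.NavierStokesRegularity.Theorems.LocalSineTubeDoorOneDirectionDoor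

variable {C : ℝ} {v : ℝ → EuclideanSpace ℝ (Fin 3) → EuclideanSpace ℝ (Fin 3)}

/-! ### profile side: unidirectional divergence-free fields are invariant along their direction -/

/-- **A `C¹` divergence-free field everywhere parallel to a fixed `e ≠ 0` has `∂ₑ V ≡ 0`**: `V = φ e` with
`φ = Vₖ/eₖ` (`eₖ ≠ 0`), and `0 = div V = ∂ₑ φ`. -/
theorem fderiv_apply_eq_zero_of_cross_eq_zero {V : EuclideanSpace ℝ (Fin 3) → EuclideanSpace ℝ (Fin 3)}
    (hV : Differentiable ℝ V) (hdiv : VectorCalculus.IsDivFree V) {e : EuclideanSpace ℝ (Fin 3)} (he : e ≠ 0)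
    (hpar : ∀ y, cross (V y) e = 0) (x : EuclideanSpace ℝ (Fin 3)) : fderiv ℝ V x e = 0 := by
  obtain ⟨k, hk⟩ := exists_apply_ne_zero he
  -- the amplitude `φ = Vₖ / eₖ`
  set φ : EuclideanSpace ℝ (Fin 3) → ℝ := fun y => V y k * (e k)⁻¹ with hφ
  have hk1 : Differentiable ℝ (fun y => V y k) := differentiable_euclidean.1 hV k
  have hφd : Differentiable ℝ φ := by
    rw [hφ]
    exact hk1.mul_const (e k)⁻¹
  have hVφ : V = fun y => φ y • e := funext fun y => by
    simp only [hφ, ← div_eq_mul_inv]; exact eq_smul_of_cross_eq_zero (hpar y) hk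
  -- `div V = ∂ₑ φ = 0`
  have hdivφ : fderiv ℝ φ x e = 0 := by
    have h := hdiv x
    rw [hVφ, divergence_smul_const e (hφd x)] at h
    exact h
  -- `∂ₑ V = (∂ₑ φ) e = 0`
  have hD : fderiv ℝ V x e = (fderiv ℝ φ x e) • e := by
    rw [hVφ, fderiv_smul_const (hφd x) e, ContinuousLinearMap.smulRight_apply]
  rw [hD, hdivφ, zero_smul]

/-- **The one-slice profile crux for the velocity direction** (`e ≠ 0` fixed): a profile of the Type-I class with
`v(s) × e = 0` on a nonempty open window of ONE slice `s < 0` is not backward-singular — `v(s) ∥ e` everywhere (slice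
analyticity), so `∂ₑ v(s) ≡ 0` (`fderiv_apply_eq_zero_of_cross_eq_zero`), the slice is translation-invariant along `e`,
and `…OneSlice.eq_zero_of_translate_eq_slice` gives `v ≡ 0`. -/
theorem not_backwardSingular_of_velocity_parallel_window (hrate : HasTypeITimeDecay C v)
    (hcont : ContinuousOn (uncurry v) (Iio (0 : ℝ) ×ˢ univ))
    (hmild : ∀ s t : ℝ, s < t → t < 0 → ∀ x,
      v t x = UnboundedOperators.heatExtension (v s) (t - s) x - oseenDuhamel 1 s v v t x)
    (hdiv : ∀ t < 0, VectorCalculus.IsDivFree (v t)) {s : ℝ} (hs : s < 0) {e : EuclideanSpace ℝ (Fin 3)} (he : e ≠ 0)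
    {U : Set (EuclideanSpace ℝ (Fin 3))} (hU : IsOpen U) (hne : U.Nonempty) (hpar : ∀ y ∈ U, cross (v s y) e = 0) :
    ¬ IsBackwardSingularPoint v 0 := by
  have hslice : AnalyticOnNhd ℝ (v s) univ := analyticOnNhd_slice hcont (bdd_of_hasTypeITimeDecay hrate) hmild hs
  have hall : ∀ y, cross (v s y) e = 0 := cross_eq_zero_spread hslice e hU hne hpar
  have hdiff : Differentiable ℝ (v s) := fun z => (hslice z (mem_univ z)).differentiableAt
  have hD : ∀ y, fderiv ℝ (v s) y e = 0 := fderiv_apply_eq_zero_of_cross_eq_zero hdiff (hdiv s hs) he hall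
  exact not_backwardSingular_of_zero (eq_zero_of_translate_eq_slice hrate hcont hmild hdiv hs he
    (translate_eq_of_fderiv_apply_eq_zero hdiff hD))

/-- **The one-slice PAIR crux for velocity directions**: a profile of the Type-I class whose velocities at any two
points of a nonempty open window of ONE slice are parallel is not backward-singular (the velocities on the window are
parallel to one fixed nonzero vector, or vanish on the window). -/
theorem not_backwardSingular_of_velocity_pairParallel_window (hrate : HasTypeITimeDecay C v)
    (hcont : ContinuousOn (uncurry v) (Iio (0 : ℝ) ×ˢ univ))
    (hmild : ∀ s t : ℝ, s < t → t < 0 → ∀ x,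
      v t x = UnboundedOperators.heatExtension (v s) (t - s) x - oseenDuhamel 1 s v v t x)
    (hdiv : ∀ t < 0, VectorCalculus.IsDivFree (v t)) {s : ℝ} (hs : s < 0)
    {U : Set (EuclideanSpace ℝ (Fin 3))} (hU : IsOpen U) (hne : U.Nonempty)
    (hpair : ∀ z ∈ U, ∀ z' ∈ U, cross (v s z) (v s z') = 0) : ¬ IsBackwardSingularPoint v 0 := by
  have cross_zero_left : ∀ e : EuclideanSpace ℝ (Fin 3), cross 0 e = 0 := fun e => by
    rw [← crossCLM_apply, map_zero, _root_.zero_apply]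
  by_cases hex : ∃ z₀ ∈ U, v s z₀ ≠ 0
  · obtain ⟨z₀, hz₀, hne0⟩ := hex
    exact not_backwardSingular_of_velocity_parallel_window hrate hcont hmild hdiv hs hne0 hU hne
      fun z hz => hpair z hz z₀ hz₀
  · push Not at hex
    have he : (EuclideanSpace.single 0 1 : EuclideanSpace ℝ (Fin 3)) ≠ 0 := by
      intro h0
      have := congrArg (fun w : EuclideanSpace ℝ (Fin 3) => w 0) h0
      simp at this
    exact not_backwardSingular_of_velocity_parallel_window hrate hcont hmild hdiv hs he hU hne
      fun z hz => by rw [hex z hz, cross_zero_left]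

/-! ### template side conditions -/

variable (e : EuclideanSpace ℝ (Fin 3))

/-- `F(x, A) = ‖x × e‖` is continuous in `(x, A)`. -/
theorem continuous_velCrossNorm :
    Continuous fun q : EuclideanSpace ℝ (Fin 3) × (EuclideanSpace ℝ (Fin 3) →L[ℝ] EuclideanSpace ℝ (Fin 3)) =>
      ‖cross q.1 e‖ := by
  have h : Continuous fun q : EuclideanSpace ℝ (Fin 3) × (EuclideanSpace ℝ (Fin 3) →L[ℝ] EuclideanSpace ℝ (Fin 3)) =>
      (crossCLM.flip e) q.1 := (crossCLM.flip e).continuous.comp continuous_fst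
  refine (continuous_norm.comp h).congr fun q => ?_
  simp only [Function.comp_apply, ContinuousLinearMap.flip_apply, crossCLM_apply]

/-- The zero set of `F(x, A) = ‖x × e‖` is invariant under positive rescalings. -/
theorem velCrossNorm_zeroSet_invariant :
    ∀ (a b : ℝ), 0 < a → 0 < b → ∀ (x : EuclideanSpace ℝ (Fin 3))
      (A : EuclideanSpace ℝ (Fin 3) →L[ℝ] EuclideanSpace ℝ (Fin 3)), ‖cross (a • x) e‖ = 0 ↔ ‖cross x e‖ = 0 := by
  intro a b ha _ x A
  have h : cross (a • x) e = a • cross x e := by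
    rw [← crossCLM_apply, ← crossCLM_apply, map_smul, _root_.smul_apply]
  rw [h, norm_smul, mul_eq_zero, Real.norm_eq_abs, abs_eq_zero, or_iff_right ha.ne']

/-- `F(x, A, x', A') = ‖x × x'‖` is continuous. -/
theorem continuous_velPairCrossNorm :
    Continuous fun q : (EuclideanSpace ℝ (Fin 3) × (EuclideanSpace ℝ (Fin 3) →L[ℝ] EuclideanSpace ℝ (Fin 3))) ×
      (EuclideanSpace ℝ (Fin 3) × (EuclideanSpace ℝ (Fin 3) →L[ℝ] EuclideanSpace ℝ (Fin 3))) => ‖cross q.1.1 q.2.1‖ := by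
  have h : Continuous fun q : (EuclideanSpace ℝ (Fin 3) × (EuclideanSpace ℝ (Fin 3) →L[ℝ] EuclideanSpace ℝ (Fin 3))) ×
      (EuclideanSpace ℝ (Fin 3) × (EuclideanSpace ℝ (Fin 3) →L[ℝ] EuclideanSpace ℝ (Fin 3))) => crossCLM q.1.1 q.2.1 :=
    crossCLM.continuous₂.comp ((continuous_fst.comp continuous_fst).prodMk (continuous_fst.comp continuous_snd))
  refine (continuous_norm.comp h).congr fun q => ?_
  simp only [Function.comp_apply, crossCLM_apply]

/-- The zero set of `F(x, A, x', A') = ‖x × x'‖` is invariant under positive rescalings. -/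
theorem velPairCrossNorm_zeroSet_invariant :
    ∀ (a b : ℝ), 0 < a → 0 < b → ∀ (x : EuclideanSpace ℝ (Fin 3)) (A : EuclideanSpace ℝ (Fin 3) →L[ℝ] EuclideanSpace ℝ (Fin 3))
      (x' : EuclideanSpace ℝ (Fin 3)) (A' : EuclideanSpace ℝ (Fin 3) →L[ℝ] EuclideanSpace ℝ (Fin 3)),
      ‖cross (a • x) (a • x')‖ = 0 ↔ ‖cross x x'‖ = 0 := by
  intro a b ha _ x A x' A'
  have h : cross (a • x) (a • x') = (a * a) • cross x x' := by
    rw [← crossCLM_apply, ← crossCLM_apply, map_smul, map_smul, _root_.smul_apply, smul_smul]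
  rw [h, norm_smul, mul_eq_zero, Real.norm_eq_abs, abs_eq_zero, or_iff_right (mul_ne_zero ha.ne' ha.ne')]

variable {e}

/-- The one-slice crux in the template's `F`-form, `F(x, A) = ‖x × e‖`. -/
theorem oneSliceCrux_velCrossNorm (he : e ≠ 0) :
    ∀ (C : ℝ) (v : ℝ → EuclideanSpace ℝ (Fin 3) → EuclideanSpace ℝ (Fin 3)),
      Literature.Analysis.FluidPDE.HasTypeITimeDecay C v →
      ContinuousOn (Function.uncurry v) (Set.Iio (0 : ℝ) ×ˢ Set.univ) →
      (∀ s t : ℝ, s < t → t < 0 → ∀ x, v t x =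
        Literature.Analysis.UnboundedOperators.heatExtension (v s) (t - s) x -
          Literature.Analysis.FluidPDE.oseenDuhamel 1 s v v t x) →
      (∀ t < 0, Literature.Analysis.FluidPDE.VectorCalculus.IsDivFree (v t)) →
      (∃ s < 0, ∃ U : Set (EuclideanSpace ℝ (Fin 3)), IsOpen U ∧ U.Nonempty ∧
        ∀ z ∈ U, (fun (x : EuclideanSpace ℝ (Fin 3)) (_ : EuclideanSpace ℝ (Fin 3) →L[ℝ] EuclideanSpace ℝ (Fin 3)) =>
          ‖Literature.Analysis.FluidPDE.cross x e‖) (v s z) (fderiv ℝ (v s) z) = 0) →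
      ¬ Literature.Analysis.FluidPDE.IsBackwardSingularPoint v 0 := by
  intro C v hrate hcont hmild hdiv hwin
  obtain ⟨s, hs, U, hU, hne, hzero⟩ := hwin
  exact not_backwardSingular_of_velocity_parallel_window hrate hcont hmild hdiv hs he hU hne fun y hy => by
    simpa only [norm_eq_zero] using hzero y hy

/-- The all-slices form of the crux (for the all-times template). -/
theorem windowCrux_velCrossNorm (he : e ≠ 0) :
    ∀ (C : ℝ) (v : ℝ → EuclideanSpace ℝ (Fin 3) → EuclideanSpace ℝ (Fin 3)),
      Literature.Analysis.FluidPDE.HasTypeITimeDecay C v →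
      ContinuousOn (Function.uncurry v) (Set.Iio (0 : ℝ) ×ˢ Set.univ) →
      (∀ s t : ℝ, s < t → t < 0 → ∀ x, v t x =
        Literature.Analysis.UnboundedOperators.heatExtension (v s) (t - s) x -
          Literature.Analysis.FluidPDE.oseenDuhamel 1 s v v t x) →
      (∀ t < 0, Literature.Analysis.FluidPDE.VectorCalculus.IsDivFree (v t)) →
      (∀ s < 0, ∃ U : Set (EuclideanSpace ℝ (Fin 3)), IsOpen U ∧ U.Nonempty ∧
        ∀ z ∈ U, (fun (x : EuclideanSpace ℝ (Fin 3)) (_ : EuclideanSpace ℝ (Fin 3) →L[ℝ] EuclideanSpace ℝ (Fin 3)) =>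
          ‖Literature.Analysis.FluidPDE.cross x e‖) (v s z) (fderiv ℝ (v s) z) = 0) →
      ¬ Literature.Analysis.FluidPDE.IsBackwardSingularPoint v 0 :=
  fun C v hrate hcont hmild hdiv hwin =>
    oneSliceCrux_velCrossNorm he C v hrate hcont hmild hdiv ⟨-1, by norm_num, hwin (-1) (by norm_num)⟩

/-- The one-slice PAIR crux in the template's `F`-form, `F(x, A, x', A') = ‖x × x'‖`. -/
theorem oneSlicePairCrux_velPairCrossNorm :
    ∀ (C : ℝ) (v : ℝ → EuclideanSpace ℝ (Fin 3) → EuclideanSpace ℝ (Fin 3)),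
      Literature.Analysis.FluidPDE.HasTypeITimeDecay C v →
      ContinuousOn (Function.uncurry v) (Set.Iio (0 : ℝ) ×ˢ Set.univ) →
      (∀ s t : ℝ, s < t → t < 0 → ∀ x, v t x =
        Literature.Analysis.UnboundedOperators.heatExtension (v s) (t - s) x -
          Literature.Analysis.FluidPDE.oseenDuhamel 1 s v v t x) →
      (∀ t < 0, Literature.Analysis.FluidPDE.VectorCalculus.IsDivFree (v t)) →
      (∃ s < 0, ∃ U : Set (EuclideanSpace ℝ (Fin 3)), IsOpen U ∧ U.Nonempty ∧
        ∀ z ∈ U, ∀ z' ∈ U, (fun (x : EuclideanSpace ℝ (Fin 3)) (_ : EuclideanSpace ℝ (Fin 3) →L[ℝ] EuclideanSpace ℝ (Fin 3))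
          (x' : EuclideanSpace ℝ (Fin 3)) (_ : EuclideanSpace ℝ (Fin 3) →L[ℝ] EuclideanSpace ℝ (Fin 3)) =>
          ‖Literature.Analysis.FluidPDE.cross x x'‖) (v s z) (fderiv ℝ (v s) z) (v s z') (fderiv ℝ (v s) z') = 0) →
      ¬ Literature.Analysis.FluidPDE.IsBackwardSingularPoint v 0 := by
  intro C v hrate hcont hmild hdiv hwin
  obtain ⟨s, hs, U, hU, hne, hzero⟩ := hwin
  exact not_backwardSingular_of_velocity_pairParallel_window hrate hcont hmild hdiv hs hU hne fun z hz z' hz' => by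
    simpa only [norm_eq_zero] using hzero z hz z' hz'

/-! ### the doors -/

/-- **THE VELOCITY-DIRECTION DOOR (all times, unconditional)**: `∫_U √(T−t)‖u × e‖ → 0` on one window ⇒ backward
bounded. -/
theorem localTubeDoorVelocityDirection :
    ∀ (ν T : ℝ), 0 < ν → 0 < T → ∀ (u : ℝ → EuclideanSpace ℝ (Fin 3) → EuclideanSpace ℝ (Fin 3))
      (p : ℝ → EuclideanSpace ℝ (Fin 3) → ℝ),
    Literature.Analysis.FluidPDE.IsClassicalNSSolutionOn (Set.Ico 0 T) ν 0 u p →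
    Literature.Analysis.FluidPDE.IsLerayHopfOn T ν 0 (u 0) u →
    Literature.Analysis.FluidPDE.HasRapidSpatialDecay (u 0) →
    ∀ (x₀ : EuclideanSpace ℝ (Fin 3)) (ρ M : ℝ), 0 < ρ →
    (∀ t ∈ Set.Ico 0 T, T - ρ ^ 2 < t → ∀ x ∈ Metric.ball x₀ ρ, ‖u t x‖ * Real.sqrt (ν * (T - t)) ≤ M) →
    ∀ (e : EuclideanSpace ℝ (Fin 3)), e ≠ 0 →
    ∀ (U : Set (EuclideanSpace ℝ (Fin 3))), IsOpen U → U.Nonempty →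
    Filter.Tendsto (fun t => ∫⁻ y in U, ENNReal.ofReal
      (Real.sqrt (T - t) * ‖Literature.Analysis.FluidPDE.cross (u t (x₀ + Real.sqrt (T - t) • y)) e‖))
      (nhdsWithin T (Set.Iio T)) (nhds 0) →
    Literature.Analysis.FluidPDE.IsBackwardBoundedAt u T x₀ := by
  intro ν T hν hT u p hsol hLH hdec x₀ ρ M hρ hM e he U hU hUne hfade
  refine genericDoor_of_profileWindowRigidity (fun x _ => ‖cross x e‖) (continuous_velCrossNorm e)
    (velCrossNorm_zeroSet_invariant e) (windowCrux_velCrossNorm he) ν T hν hT u p hsol hLH hdec x₀ ρ M hρ hM U hU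
    hUne ?_
  refine hfade.congr fun t => ?_
  refine lintegral_congr fun y => ?_
  have hs : 0 ≤ Real.sqrt (T - t) := Real.sqrt_nonneg _
  have h : cross (Real.sqrt (T - t) • u t (x₀ + Real.sqrt (T - t) • y)) e =
      Real.sqrt (T - t) • cross (u t (x₀ + Real.sqrt (T - t) • y)) e := by
    rw [← crossCLM_apply, ← crossCLM_apply, map_smul, _root_.smul_apply]
  rw [h, norm_smul, Real.norm_eq_abs, abs_of_nonneg hs, abs_of_nonneg (mul_nonneg hs (norm_nonneg _))]

/-- **THE SEQUENTIAL VELOCITY-DIRECTION DOOR (unconditional)**: fading along bounded-gap times suffices. -/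
theorem sequentialVelocityDirectionDoor :
    ∀ (ν T : ℝ), 0 < ν → 0 < T → ∀ (u : ℝ → EuclideanSpace ℝ (Fin 3) → EuclideanSpace ℝ (Fin 3))
      (p : ℝ → EuclideanSpace ℝ (Fin 3) → ℝ),
    Literature.Analysis.FluidPDE.IsClassicalNSSolutionOn (Set.Ico 0 T) ν 0 u p →
    Literature.Analysis.FluidPDE.IsLerayHopfOn T ν 0 (u 0) u →
    Literature.Analysis.FluidPDE.HasRapidSpatialDecay (u 0) →
    ∀ (x₀ : EuclideanSpace ℝ (Fin 3)) (ρ M : ℝ), 0 < ρ →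
    (∀ t ∈ Set.Ico 0 T, T - ρ ^ 2 < t → ∀ x ∈ Metric.ball x₀ ρ, ‖u t x‖ * Real.sqrt (ν * (T - t)) ≤ M) →
    ∀ (e : EuclideanSpace ℝ (Fin 3)), e ≠ 0 →
    ∀ (U : Set (EuclideanSpace ℝ (Fin 3))), IsOpen U → U.Nonempty →
    ∀ (t : ℕ → ℝ) (c : ℝ), 0 < c → (∀ k, t k ∈ Set.Ico 0 T) → Filter.Tendsto t Filter.atTop (nhds T) →
    (∀ k, c * (T - t k) ≤ T - t (k + 1)) →
    Filter.Tendsto (fun k => ∫⁻ y in U, ENNReal.ofReal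
      (Real.sqrt (T - t k) * ‖Literature.Analysis.FluidPDE.cross (u (t k) (x₀ + Real.sqrt (T - t k) • y)) e‖))
      Filter.atTop (nhds 0) →
    Literature.Analysis.FluidPDE.IsBackwardBoundedAt u T x₀ := by
  intro ν T hν hT u p hsol hLH hdec x₀ ρ M hρ hM e he U hU hUne t c hc htk htT hgap hfade
  refine sequentialDoor_of_oneSliceWindowRigidity (fun x _ => ‖cross x e‖) (continuous_velCrossNorm e)
    (velCrossNorm_zeroSet_invariant e) (oneSliceCrux_velCrossNorm he) ν T hν hT u p hsol hLH hdec x₀ ρ M hρ hM U hU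
    hUne t c hc htk htT hgap ?_
  refine hfade.congr fun k => ?_
  refine lintegral_congr fun y => ?_
  have hs : 0 ≤ Real.sqrt (T - t k) := Real.sqrt_nonneg _
  have h : cross (Real.sqrt (T - t k) • u (t k) (x₀ + Real.sqrt (T - t k) • y)) e =
      Real.sqrt (T - t k) • cross (u (t k) (x₀ + Real.sqrt (T - t k) • y)) e := by
    rw [← crossCLM_apply, ← crossCLM_apply, map_smul, _root_.smul_apply]
  rw [h, norm_smul, Real.norm_eq_abs, abs_of_nonneg hs, abs_of_nonneg (mul_nonneg hs (norm_nonneg _))]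

/-- **THE MOST-TIMES VELOCITY-DIRECTION DOOR (unconditional)**: fading along all times outside an exceptional set of
density `→ 0` at `T` suffices. -/
theorem mostTimesVelocityDirectionDoor :
    ∀ (ν T : ℝ), 0 < ν → 0 < T → ∀ (u : ℝ → EuclideanSpace ℝ (Fin 3) → EuclideanSpace ℝ (Fin 3))
      (p : ℝ → EuclideanSpace ℝ (Fin 3) → ℝ),
    Literature.Analysis.FluidPDE.IsClassicalNSSolutionOn (Set.Ico 0 T) ν 0 u p →
    Literature.Analysis.FluidPDE.IsLerayHopfOn T ν 0 (u 0) u →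
    Literature.Analysis.FluidPDE.HasRapidSpatialDecay (u 0) →
    ∀ (x₀ : EuclideanSpace ℝ (Fin 3)) (ρ M : ℝ), 0 < ρ →
    (∀ t ∈ Set.Ico 0 T, T - ρ ^ 2 < t → ∀ x ∈ Metric.ball x₀ ρ, ‖u t x‖ * Real.sqrt (ν * (T - t)) ≤ M) →
    ∀ (e : EuclideanSpace ℝ (Fin 3)), e ≠ 0 →
    ∀ (U : Set (EuclideanSpace ℝ (Fin 3))), IsOpen U → U.Nonempty →
    ∀ (E : Set ℝ), (∀ ε > 0, ∀ᶠ h in nhdsWithin (0 : ℝ) (Set.Ioi 0),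
      MeasureTheory.volume (E ∩ Set.Ioo (T - h) T) ≤ ENNReal.ofReal (ε * h)) →
    (∀ t : ℕ → ℝ, (∀ k, t k ∈ Set.Ico 0 T ∧ t k ∉ E) → Filter.Tendsto t Filter.atTop (nhds T) →
      Filter.Tendsto (fun k => ∫⁻ y in U, ENNReal.ofReal
        (Real.sqrt (T - t k) * ‖Literature.Analysis.FluidPDE.cross (u (t k) (x₀ + Real.sqrt (T - t k) • y)) e‖))
        Filter.atTop (nhds 0)) →
    Literature.Analysis.FluidPDE.IsBackwardBoundedAt u T x₀ := by
  intro ν T hν hT u p hsol hLH hdec x₀ ρ M hρ hM e he U hU hUne E hE hfadeE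
  refine bandDoor_of_oneSliceWindowRigidity (fun x _ => ‖cross x e‖) (continuous_velCrossNorm e)
    (velCrossNorm_zeroSet_invariant e) (oneSliceCrux_velCrossNorm he) ν T hν hT u p hsol hLH hdec x₀ ρ M hρ hM U hU
    hUne (fun t' => t' ∉ E) (1 / 2) (by norm_num) (band_of_densityZero hT hE) fun t htk htT => ?_
  refine (hfadeE t htk htT).congr fun k => ?_
  refine lintegral_congr fun y => ?_
  have hs : 0 ≤ Real.sqrt (T - t k) := Real.sqrt_nonneg _
  have h : cross (Real.sqrt (T - t k) • u (t k) (x₀ + Real.sqrt (T - t k) • y)) e =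
      Real.sqrt (T - t k) • cross (u (t k) (x₀ + Real.sqrt (T - t k) • y)) e := by
    rw [← crossCLM_apply, ← crossCLM_apply, map_smul, _root_.smul_apply]
  rw [h, norm_smul, Real.norm_eq_abs, abs_of_nonneg hs, abs_of_nonneg (mul_nonneg hs (norm_nonneg _))]

/-- **THE SEQUENTIAL VELOCITY CROSS DOOR (unconditional, direction-free)**: pairwise coherence
`∬_{U×U} (T−tₖ)‖u(tₖ,x₀+√(T−tₖ)y) × u(tₖ,x₀+√(T−tₖ)y')‖ → 0` along bounded-gap times ⇒ backward bounded. -/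
theorem sequentialVelocityCrossDoor :
    ∀ (ν T : ℝ), 0 < ν → 0 < T → ∀ (u : ℝ → EuclideanSpace ℝ (Fin 3) → EuclideanSpace ℝ (Fin 3))
      (p : ℝ → EuclideanSpace ℝ (Fin 3) → ℝ),
    Literature.Analysis.FluidPDE.IsClassicalNSSolutionOn (Set.Ico 0 T) ν 0 u p →
    Literature.Analysis.FluidPDE.IsLerayHopfOn T ν 0 (u 0) u →
    Literature.Analysis.FluidPDE.HasRapidSpatialDecay (u 0) →
    ∀ (x₀ : EuclideanSpace ℝ (Fin 3)) (ρ M : ℝ), 0 < ρ →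
    (∀ t ∈ Set.Ico 0 T, T - ρ ^ 2 < t → ∀ x ∈ Metric.ball x₀ ρ, ‖u t x‖ * Real.sqrt (ν * (T - t)) ≤ M) →
    ∀ (U : Set (EuclideanSpace ℝ (Fin 3))), IsOpen U → U.Nonempty →
    ∀ (t : ℕ → ℝ) (c : ℝ), 0 < c → (∀ k, t k ∈ Set.Ico 0 T) → Filter.Tendsto t Filter.atTop (nhds T) →
    (∀ k, c * (T - t k) ≤ T - t (k + 1)) →
    Filter.Tendsto (fun k => ∫⁻ q in U ×ˢ U, ENNReal.ofReal
      ((T - t k) * ‖Literature.Analysis.FluidPDE.cross (u (t k) (x₀ + Real.sqrt (T - t k) • q.1))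
        (u (t k) (x₀ + Real.sqrt (T - t k) • q.2))‖)) Filter.atTop (nhds 0) →
    Literature.Analysis.FluidPDE.IsBackwardBoundedAt u T x₀ := by
  intro ν T hν hT u p hsol hLH hdec x₀ ρ M hρ hM U hU hUne t c hc htk htT hgap hfade
  refine sequentialPairDoor_of_oneSlicePairWindowRigidity (fun x _ x' _ => ‖cross x x'‖) continuous_velPairCrossNorm
    velPairCrossNorm_zeroSet_invariant oneSlicePairCrux_velPairCrossNorm ν T hν hT u p hsol hLH hdec x₀ ρ M hρ hM U hU
    hUne t c hc htk htT hgap ?_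
  refine hfade.congr fun k => ?_
  refine lintegral_congr fun q => ?_
  have ht : 0 ≤ T - t k := (sub_pos.2 (htk k).2).le
  have h : cross (Real.sqrt (T - t k) • u (t k) (x₀ + Real.sqrt (T - t k) • q.1))
      (Real.sqrt (T - t k) • u (t k) (x₀ + Real.sqrt (T - t k) • q.2)) =
      (Real.sqrt (T - t k) * Real.sqrt (T - t k)) • cross (u (t k) (x₀ + Real.sqrt (T - t k) • q.1))
        (u (t k) (x₀ + Real.sqrt (T - t k) • q.2)) := by
    rw [← crossCLM_apply, ← crossCLM_apply, map_smul, map_smul, _root_.smul_apply, smul_smul]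
  rw [h, Real.mul_self_sqrt ht, norm_smul, Real.norm_eq_abs, abs_of_nonneg ht,
    abs_of_nonneg (mul_nonneg ht (norm_nonneg _))]

/-- **THE MOST-TIMES VELOCITY CROSS DOOR (unconditional, direction-free)**. -/
theorem mostTimesVelocityCrossDoor :
    ∀ (ν T : ℝ), 0 < ν → 0 < T → ∀ (u : ℝ → EuclideanSpace ℝ (Fin 3) → EuclideanSpace ℝ (Fin 3))
      (p : ℝ → EuclideanSpace ℝ (Fin 3) → ℝ),
    Literature.Analysis.FluidPDE.IsClassicalNSSolutionOn (Set.Ico 0 T) ν 0 u p →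
    Literature.Analysis.FluidPDE.IsLerayHopfOn T ν 0 (u 0) u →
    Literature.Analysis.FluidPDE.HasRapidSpatialDecay (u 0) →
    ∀ (x₀ : EuclideanSpace ℝ (Fin 3)) (ρ M : ℝ), 0 < ρ →
    (∀ t ∈ Set.Ico 0 T, T - ρ ^ 2 < t → ∀ x ∈ Metric.ball x₀ ρ, ‖u t x‖ * Real.sqrt (ν * (T - t)) ≤ M) →
    ∀ (U : Set (EuclideanSpace ℝ (Fin 3))), IsOpen U → U.Nonempty →
    ∀ (E : Set ℝ), (∀ ε > 0, ∀ᶠ h in nhdsWithin (0 : ℝ) (Set.Ioi 0),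
      MeasureTheory.volume (E ∩ Set.Ioo (T - h) T) ≤ ENNReal.ofReal (ε * h)) →
    (∀ t : ℕ → ℝ, (∀ k, t k ∈ Set.Ico 0 T ∧ t k ∉ E) → Filter.Tendsto t Filter.atTop (nhds T) →
      Filter.Tendsto (fun k => ∫⁻ q in U ×ˢ U, ENNReal.ofReal
        ((T - t k) * ‖Literature.Analysis.FluidPDE.cross (u (t k) (x₀ + Real.sqrt (T - t k) • q.1))
          (u (t k) (x₀ + Real.sqrt (T - t k) • q.2))‖)) Filter.atTop (nhds 0)) →
    Literature.Analysis.FluidPDE.IsBackwardBoundedAt u T x₀ := by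
  intro ν T hν hT u p hsol hLH hdec x₀ ρ M hρ hM U hU hUne E hE hfadeE
  refine bandPairDoor_of_oneSlicePairWindowRigidity (fun x _ x' _ => ‖cross x x'‖) continuous_velPairCrossNorm
    velPairCrossNorm_zeroSet_invariant oneSlicePairCrux_velPairCrossNorm ν T hν hT u p hsol hLH hdec x₀ ρ M hρ hM U hU
    hUne (fun t' => t' ∉ E) (1 / 2) (by norm_num) (band_of_densityZero hT hE) fun t htk htT => ?_
  refine (hfadeE t htk htT).congr fun k => ?_
  refine lintegral_congr fun q => ?_
  have ht : 0 ≤ T - t k := (sub_pos.2 (htk k).1.2).le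
  have h : cross (Real.sqrt (T - t k) • u (t k) (x₀ + Real.sqrt (T - t k) • q.1))
      (Real.sqrt (T - t k) • u (t k) (x₀ + Real.sqrt (T - t k) • q.2)) =
      (Real.sqrt (T - t k) * Real.sqrt (T - t k)) • cross (u (t k) (x₀ + Real.sqrt (T - t k) • q.1))
        (u (t k) (x₀ + Real.sqrt (T - t k) • q.2)) := by
    rw [← crossCLM_apply, ← crossCLM_apply, map_smul, map_smul, _root_.smul_apply, smul_smul]
  rw [h, Real.mul_self_sqrt ht, norm_smul, Real.norm_eq_abs, abs_of_nonneg ht,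
    abs_of_nonneg (mul_nonneg ht (norm_nonneg _))]

end Summit.NavierStokesRegularity.NavierStokesRegularity.Theorems.LocalSineTubeDoorVelocityDirectionDoor

end
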